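import Summits.Ventures.LatticeQCDFlow.Scaling.BooleanStarThreeStateReduction

/-!
HONEST FRAMING: exact (Metropolis-corrected) sampling algorithms for lattice gauge theory; figures
of merit are autocorrelation/cost numbers at stated couplings and volumes; no continuum-physics
claim.

# BooleanStarThreeStateValue — THE EXACT VALUE OF THE ALIGNED THREE-STATE CLASS (CRAMER'S RULE, AN `M`-MATRIX: `det ≥ h³`, ALL COFACTORS `≥ 0`), AND THE LAW
# FOR ANY POTENTIAL `Ψa(D,N)`: WITH `U, V, W` SO DEFINED, ITEM 1 (ii) FOR THE HOMOGENEOUS BOOLEAN STAR NEEDS ONLY A SEPARATION OF `Ψa` ACROSS `D` (TRIVIAL FOR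
# `D`-SLOPE `1`, `N`-LIPSCHITZ `1`) AND THE REDRAW CONTRACTION `μ_0(b)U(D,N) + μ_0(b̄)V(D,N) ≤ (1−ρ)Ψa(D,N)` (lean-2 GEN-32, ours)

Venture-side (OURS).  Cell `lqcd-flow` (pub-lqcd), unit `pub-lqcd-lean-2-g32`, 2026-08-29.  Chapter S, file 6, on top of `BooleanStarThreeStateReduction` (S5).  A conserved class of
the aligned sector (memo §9a) with `G` good levels, `N` bad levels and `D` defects at its `U`-state has the 3 × 3 cycle system
`(t+h)u = hψu + c(Gu + Nv + Dw)`, `(t+h)v = hψv + c((G+1)(rr·u + (1−rr)v) + (N−1)v + D(rr·w + (1−rr)v))`, `(t+h)w = hψw + c((G+1)(rr·u + (1−rr)w) + Nv + (D−1)w)`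
(`c = t/K`, `h = (1−t)w_0`, `rr` the disliked acceptance, `ψu, ψv, ψw` the potential at the three states).  Its matrix is `h·1 + L` with `L` a `Z`-matrix whose rows sum to zero
(`t = c(G+N+D)`), so `det = h³ + h²·tr L + h·(principal minors) ≥ h³ > 0` and all nine cofactors are `≥ 0`: the Cramer solution exists, is explicit, and is `≥ 0` for `ψ ≥ 0`.
Defining `U(D,N)`, `V(D,N)`, `W(D,N)` as the `u`-, `v`-, `w`-components of the classes of `(bb;D,N)`, `(bb;D,N+1)`, `(bb;D+1,N)` respectively discharges the three aligned
equations and the non-negativity in S5's `boolStar_mixingTime_le_of_threeState`.  Hypothesis-equations throughout; no definitions.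

## What is proved

* §1 **`threeState_cramer`** (the explicit `det`, `det_u`, `det_v`, `det_w` solve the system whenever `det ≠ 0`; `field_simp` + `ring`).
* §2 `threeState_diag`, **`threeState_det_pos`** (`h³ ≤ det`, `0 < det` for `h > 0`, `c, N, D, rr ≥ 0`, `G ≥ −1`); §3 `threeState_rowsum`, **`threeState_value_bounds`** (each value is a
  weighted average of the three data: `min ≤ u, v, w ≤ max`), `threeState_solution_nonneg`.
* §4 `boolStar_cnt_total` (the four type counts sum to `K`) and **`boolStar_mixingTime_le_of_potential`**: for ANY `Ψa ≥ 0` (`≤ Ψ_max`, `≥ 1` where a cold level differs) and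
  `U, V, W` the Cramer values above, the SEPARATION `max{Ψa(D−1,N+1), Ψa(D−1,N), Ψa(D−2,N+1)} ≤ min{Ψa(D+1,N), Ψa(D+1,N−1), Ψa(D,N)}` on `D ≥ 1` (⇒ the monotonicity
  `V(D−1,N) ≤ W(D,N)` by §3) and the REDRAW CONTRACTION `μ_0(b)U + μ_0(b̄)V ≤ (1−ρ)Ψa` at every pair (`0 < ρ ≤ 1`) give `t_mix(ε) ≤ ⌈(4/((1−t)w_0·ρ))·log((e·Ψ_max+1)/ε)⌉₊`.

Reading (no numerics implied): for `Ψa(D,N) = D + φ(N) + φ(N+D)` with `φ` `1`-Lipschitz (the memo's Huber term) the separation holds identically (each of the nine differences is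
`k − (φ-differences) ≥ k − k = 0`, `k ∈ {1,2,3}`), so what remains of OPEN-MATH item 1 (ii) for the homogeneous Boolean star is the ONE redraw-contraction inequality — toy value
`ρ ≥ 0.44·(p/K)·min{1,t/h}` up to `K = 256` for `N* = (K+1)μ_1(b̄)`, `W = max{4rK/p², 2}`.  NOT CLAIMED: it; anything measured.  Literature grade (cell rule): OWN, elementary;
nothing cited as a fact; no new bib keys.
-/

noncomputable section

namespace Summit.Ventures.LatticeQCDFlow.Scaling

/-! ## §1 The class system and its Cramer solution -/

/-- **THE THREE-STATE CLASS SYSTEM IS SOLVED BY CRAMER'S RULE.**  For a conserved class of the aligned sector with `G` good levels, `N` bad levels and `D` defects at its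
`U`-state, per-level ring rate `c = t/K`, redraw rate `h`, disliked acceptance `rr`, and potential values `ψu, ψv, ψw` at the `U`-, `V`-, `W`-state, the explicit
`u = det_u/det`, `v = det_v/det`, `w = det_w/det` (`det ≠ 0`) satisfy the three cycle equations
`(t+h)u = hψu + c(Gu + Nv + Dw)`, `(t+h)v = hψv + c((G+1)(rr·u + (1−rr)v) + (N−1)v + D(rr·w + (1−rr)v))`, `(t+h)w = hψw + c((G+1)(rr·u + (1−rr)w) + Nv + (D−1)w)`. [ours] -/
theorem threeState_cramer {t h c G N D rr ψu ψv ψw p1 p2 p3 det detu detv detw u v w : ℝ}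
    (hp1 : p1 = t + h - c * G) (hp2 : p2 = t + h - c * ((G + 1) * (1 - rr) + (N - 1) + D * (1 - rr)))
    (hp3 : p3 = t + h - c * ((G + 1) * (1 - rr) + (D - 1)))
    (hdet : det = p1 * (p2 * p3 - (c * D * rr) * (c * N)) - c ^ 2 * N * (G + 1) * rr * (p3 + c * D * rr)
      - c ^ 2 * D * (G + 1) * rr * (c * N + p2))
    (hdetu : detu = h * ψu * (p2 * p3 - (c * D * rr) * (c * N)) + h * ψv * (c * N * (p3 + c * D)) + h * ψw * (c * D * (c * N * rr + p2)))
    (hdetv : detv = h * ψv * (p1 * p3 - c ^ 2 * D * (G + 1) * rr) + h * ψu * (c * (G + 1) * rr * (p3 + c * D * rr))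
      + h * ψw * (c * D * rr * (p1 + c * (G + 1))))
    (hdetw : detw = h * ψw * (p1 * p2 - c ^ 2 * N * (G + 1) * rr) + h * ψv * (c * N * (p1 + c * (G + 1) * rr))
      + h * ψu * (c * (G + 1) * rr * (c * N + p2)))
    (hdet0 : det ≠ 0) (hu : u = detu / det) (hv : v = detv / det) (hw : w = detw / det) :
    (t + h) * u = h * ψu + c * (G * u + N * v + D * w)
    ∧ (t + h) * v = h * ψv + c * ((G + 1) * (rr * u + (1 - rr) * v) + (N - 1) * v + D * (rr * w + (1 - rr) * v))
    ∧ (t + h) * w = h * ψw + c * ((G + 1) * (rr * u + (1 - rr) * w) + N * v + (D - 1) * w) := by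
  subst hp1 hp2 hp3
  subst hdetu hdetv hdetw
  rw [hu, hv, hw]
  refine ⟨?_, ?_, ?_⟩
  · rw [← sub_eq_zero]
    field_simp
    rw [hdet]; ring
  · rw [← sub_eq_zero]
    field_simp
    rw [hdet]; ring
  · rw [← sub_eq_zero]
    field_simp
    rw [hdet]; ring


/-! ## §2 Signs: the matrix is `h·1 + L` with `L` a zero-row-sum `Z`-matrix -/

/-- **The diagonal entries** under `t = c(G+N+D)`: `p1 = h + c(N+D)`, `p2 = h + c·rr·(G+1+D)`, `p3 = h + c((G+1)rr + N)`. [ours] -/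
theorem threeState_diag {t h c G N D rr p1 p2 p3 : ℝ} (ht : t = c * (G + N + D))
    (hp1 : p1 = t + h - c * G) (hp2 : p2 = t + h - c * ((G + 1) * (1 - rr) + (N - 1) + D * (1 - rr)))
    (hp3 : p3 = t + h - c * ((G + 1) * (1 - rr) + (D - 1))) :
    p1 = h + c * (N + D) ∧ p2 = h + c * rr * (G + 1 + D) ∧ p3 = h + c * ((G + 1) * rr + N) := by
  refine ⟨?_, ?_, ?_⟩
  · rw [hp1, ht]; ring
  · rw [hp2, ht]; ring
  · rw [hp3, ht]; ring

/-- **`det = h³ + h²·tr L + h·(sum of principal minors of L)`** (`det L = 0` because the rows of `L` sum to zero), hence **`det ≥ h³ > 0`** for `h > 0`, `c ≥ 0`, `G, N, D ≥ 0`,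
`0 ≤ rr`. [ours] -/
theorem threeState_det_pos {t h c G N D rr p1 p2 p3 det : ℝ} (ht : t = c * (G + N + D)) (hh : 0 < h) (hc : 0 ≤ c) (hG : 0 ≤ G + 1) (hN : 0 ≤ N)
    (hD : 0 ≤ D) (hrr : 0 ≤ rr)
    (hp1 : p1 = t + h - c * G) (hp2 : p2 = t + h - c * ((G + 1) * (1 - rr) + (N - 1) + D * (1 - rr)))
    (hp3 : p3 = t + h - c * ((G + 1) * (1 - rr) + (D - 1)))
    (hdet : det = p1 * (p2 * p3 - (c * D * rr) * (c * N)) - c ^ 2 * N * (G + 1) * rr * (p3 + c * D * rr)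
      - c ^ 2 * D * (G + 1) * rr * (c * N + p2)) :
    h ^ 3 ≤ det ∧ 0 < det := by
  generalize eG1 : G + 1 = G1 at hG
  have eG : G = G1 - 1 := by linarith
  subst eG
  have e : det = h ^ 3 + h ^ 2 * (c * (N + D) + c * rr * (G1 + D) + c * (G1 * rr + N))
      + h * (c ^ 2 * rr * (N * D + D * (G1 + D)) + c ^ 2 * (N * (N + D) + N * G1 * rr)
        + c ^ 2 * rr * ((G1 + D) * G1 * rr + G1 * N)) := by
    rw [hdet, hp1, hp2, hp3, ht]; ring
  have h1 : 0 ≤ h ^ 2 * (c * (N + D) + c * rr * (G1 + D) + c * (G1 * rr + N)) := by positivity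
  have h2 : 0 ≤ h * (c ^ 2 * rr * (N * D + D * (G1 + D)) + c ^ 2 * (N * (N + D) + N * G1 * rr)
        + c ^ 2 * rr * ((G1 + D) * G1 * rr + G1 * N)) := by positivity
  have h3 : 0 < h ^ 3 := by positivity
  constructor <;> linarith

/-! ## §3 The value is a weighted average of `ψu, ψv, ψw` -/

/-- **Row sums:** the cofactor weights of each Cramer numerator add up to `det/h` (the constant vector solves the system with constant data), under `t = c(G+N+D)`. [ours] -/
theorem threeState_rowsum {t h c G N D rr p1 p2 p3 det : ℝ} (ht : t = c * (G + N + D))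
    (hp1 : p1 = t + h - c * G) (hp2 : p2 = t + h - c * ((G + 1) * (1 - rr) + (N - 1) + D * (1 - rr)))
    (hp3 : p3 = t + h - c * ((G + 1) * (1 - rr) + (D - 1)))
    (hdet : det = p1 * (p2 * p3 - (c * D * rr) * (c * N)) - c ^ 2 * N * (G + 1) * rr * (p3 + c * D * rr)
      - c ^ 2 * D * (G + 1) * rr * (c * N + p2)) :
    h * ((p2 * p3 - (c * D * rr) * (c * N)) + (c * N * (p3 + c * D)) + (c * D * (c * N * rr + p2))) = det
    ∧ h * ((p1 * p3 - c ^ 2 * D * (G + 1) * rr) + (c * (G + 1) * rr * (p3 + c * D * rr)) + (c * D * rr * (p1 + c * (G + 1)))) = det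
    ∧ h * ((p1 * p2 - c ^ 2 * N * (G + 1) * rr) + (c * N * (p1 + c * (G + 1) * rr)) + (c * (G + 1) * rr * (c * N + p2))) = det := by
  refine ⟨?_, ?_, ?_⟩ <;> rw [hdet, hp1, hp2, hp3, ht] <;> ring

/-- **THE VALUE LIES BETWEEN THE SMALLEST AND THE LARGEST DATUM:** for `m ≤ ψu, ψv, ψw ≤ M'` (and the sign hypotheses of `threeState_solution_nonneg`),
`m ≤ u, v, w ≤ M'`. [ours] -/
theorem threeState_value_bounds {t h c G N D rr ψu ψv ψw p1 p2 p3 det detu detv detw u v w m M' : ℝ} (ht : t = c * (G + N + D))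
    (hh : 0 < h) (hc : 0 ≤ c) (hG : 0 ≤ G + 1) (hN : 0 ≤ N) (hD : 0 ≤ D) (hrr0 : 0 ≤ rr)
    (hmu : m ≤ ψu) (hmv : m ≤ ψv) (hmw : m ≤ ψw) (hMu : ψu ≤ M') (hMv : ψv ≤ M') (hMw : ψw ≤ M')
    (hp1 : p1 = t + h - c * G) (hp2 : p2 = t + h - c * ((G + 1) * (1 - rr) + (N - 1) + D * (1 - rr)))
    (hp3 : p3 = t + h - c * ((G + 1) * (1 - rr) + (D - 1)))
    (hdet : det = p1 * (p2 * p3 - (c * D * rr) * (c * N)) - c ^ 2 * N * (G + 1) * rr * (p3 + c * D * rr)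
      - c ^ 2 * D * (G + 1) * rr * (c * N + p2))
    (hdetu : detu = h * ψu * (p2 * p3 - (c * D * rr) * (c * N)) + h * ψv * (c * N * (p3 + c * D)) + h * ψw * (c * D * (c * N * rr + p2)))
    (hdetv : detv = h * ψv * (p1 * p3 - c ^ 2 * D * (G + 1) * rr) + h * ψu * (c * (G + 1) * rr * (p3 + c * D * rr))
      + h * ψw * (c * D * rr * (p1 + c * (G + 1))))
    (hdetw : detw = h * ψw * (p1 * p2 - c ^ 2 * N * (G + 1) * rr) + h * ψv * (c * N * (p1 + c * (G + 1) * rr))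
      + h * ψu * (c * (G + 1) * rr * (c * N + p2)))
    (hu : u = detu / det) (hv : v = detv / det) (hw : w = detw / det) :
    (m ≤ u ∧ u ≤ M') ∧ (m ≤ v ∧ v ≤ M') ∧ (m ≤ w ∧ w ≤ M') := by
  have hdetpos := (threeState_det_pos ht hh hc hG hN hD hrr0 hp1 hp2 hp3 hdet).2
  obtain ⟨r1, r2, r3⟩ := threeState_rowsum ht hp1 hp2 hp3 hdet
  obtain ⟨e1, e2, e3⟩ := threeState_diag ht hp1 hp2 hp3
  generalize eG1 : G + 1 = G1 at hG e2 e3 hdetu hdetv hdetw r1 r2 r3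
  have hq1 : 0 ≤ p1 := by rw [e1]; positivity
  have hq2 : 0 ≤ p2 := by rw [e2]; positivity
  have hq3 : 0 ≤ p3 := by rw [e3]; positivity
  have c11 : 0 ≤ p2 * p3 - (c * D * rr) * (c * N) := by
    have : p2 * p3 - (c * D * rr) * (c * N) = h ^ 2 + h * (c * rr * (G1 + D) + c * (G1 * rr + N))
        + c ^ 2 * rr * ((G1 + D) * G1 * rr + G1 * N) := by rw [e2, e3]; ring
    rw [this]; positivity
  have c12 : 0 ≤ c * N * (p3 + c * D) := by positivity
  have c13 : 0 ≤ c * D * (c * N * rr + p2) := by positivity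
  have c21 : 0 ≤ c * G1 * rr * (p3 + c * D * rr) := by positivity
  have c22 : 0 ≤ p1 * p3 - c ^ 2 * D * G1 * rr := by
    have : p1 * p3 - c ^ 2 * D * G1 * rr = h ^ 2 + h * (c * (N + D) + c * (G1 * rr + N)) + c ^ 2 * (N + D) * N + c ^ 2 * N * G1 * rr := by
      rw [e1, e3]; ring
    rw [this]; positivity
  have c23 : 0 ≤ c * D * rr * (p1 + c * G1) := by positivity
  have c31 : 0 ≤ c * G1 * rr * (c * N + p2) := by positivity
  have c32 : 0 ≤ c * N * (p1 + c * G1 * rr) := by positivity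
  have c33 : 0 ≤ p1 * p2 - c ^ 2 * N * G1 * rr := by
    have : p1 * p2 - c ^ 2 * N * G1 * rr = h ^ 2 + h * (c * (N + D) + c * rr * (G1 + D)) + c ^ 2 * rr * (N * D + D * (G1 + D)) := by
      rw [e1, e2]; ring
    rw [this]; positivity
  have hh0 := hh.le
  -- `det·m ≤ det_u ≤ det·M'` etc., by the row sums
  have lo : ∀ {x y z Cx Cy Cz : ℝ}, m ≤ x → m ≤ y → m ≤ z → 0 ≤ Cx → 0 ≤ Cy → 0 ≤ Cz →
      m * (h * (Cx + Cy + Cz)) ≤ h * x * Cx + h * y * Cy + h * z * Cz := by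
    intro x y z Cx Cy Cz hx hy hz hCx hCy hCz
    have f := add_nonneg (add_nonneg (mul_nonneg (mul_nonneg hh0 (sub_nonneg.mpr hx)) hCx)
      (mul_nonneg (mul_nonneg hh0 (sub_nonneg.mpr hy)) hCy)) (mul_nonneg (mul_nonneg hh0 (sub_nonneg.mpr hz)) hCz)
    have e : h * x * Cx + h * y * Cy + h * z * Cz - m * (h * (Cx + Cy + Cz))
        = h * (x - m) * Cx + h * (y - m) * Cy + h * (z - m) * Cz := by ring
    linarith [f, e]
  have hi : ∀ {x y z Cx Cy Cz : ℝ}, x ≤ M' → y ≤ M' → z ≤ M' → 0 ≤ Cx → 0 ≤ Cy → 0 ≤ Cz →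
      h * x * Cx + h * y * Cy + h * z * Cz ≤ M' * (h * (Cx + Cy + Cz)) := by
    intro x y z Cx Cy Cz hx hy hz hCx hCy hCz
    have f := add_nonneg (add_nonneg (mul_nonneg (mul_nonneg hh0 (sub_nonneg.mpr hx)) hCx)
      (mul_nonneg (mul_nonneg hh0 (sub_nonneg.mpr hy)) hCy)) (mul_nonneg (mul_nonneg hh0 (sub_nonneg.mpr hz)) hCz)
    have e : M' * (h * (Cx + Cy + Cz)) - (h * x * Cx + h * y * Cy + h * z * Cz)
        = h * (M' - x) * Cx + h * (M' - y) * Cy + h * (M' - z) * Cz := by ring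
    linarith [f, e]
  refine ⟨⟨?_, ?_⟩, ⟨?_, ?_⟩, ⟨?_, ?_⟩⟩
  · rw [hu, le_div_iff₀ hdetpos, hdetu, ← r1]; exact lo hmu hmv hmw c11 c12 c13
  · rw [hu, div_le_iff₀ hdetpos, hdetu, ← r1]; exact hi hMu hMv hMw c11 c12 c13
  · rw [hv, le_div_iff₀ hdetpos, hdetv, ← r2]; exact lo hmv hmu hmw c22 c21 c23
  · rw [hv, div_le_iff₀ hdetpos, hdetv, ← r2]; exact hi hMv hMu hMw c22 c21 c23
  · rw [hw, le_div_iff₀ hdetpos, hdetw, ← r3]; exact lo hmw hmv hmu c33 c32 c31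
  · rw [hw, div_le_iff₀ hdetpos, hdetw, ← r3]; exact hi hMw hMv hMu c33 c32 c31


/-- **`u, v, w ≥ 0` for `ψ ≥ 0`** (from `threeState_value_bounds` with `m = 0`). [ours] -/
theorem threeState_solution_nonneg {t h c G N D rr ψu ψv ψw p1 p2 p3 det detu detv detw u v w : ℝ} (ht : t = c * (G + N + D))
    (hh : 0 < h) (hc : 0 ≤ c) (hG : 0 ≤ G + 1) (hN : 0 ≤ N) (hD : 0 ≤ D) (hrr0 : 0 ≤ rr)
    (hψu : 0 ≤ ψu) (hψv : 0 ≤ ψv) (hψw : 0 ≤ ψw)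
    (hp1 : p1 = t + h - c * G) (hp2 : p2 = t + h - c * ((G + 1) * (1 - rr) + (N - 1) + D * (1 - rr)))
    (hp3 : p3 = t + h - c * ((G + 1) * (1 - rr) + (D - 1)))
    (hdet : det = p1 * (p2 * p3 - (c * D * rr) * (c * N)) - c ^ 2 * N * (G + 1) * rr * (p3 + c * D * rr)
      - c ^ 2 * D * (G + 1) * rr * (c * N + p2))
    (hdetu : detu = h * ψu * (p2 * p3 - (c * D * rr) * (c * N)) + h * ψv * (c * N * (p3 + c * D)) + h * ψw * (c * D * (c * N * rr + p2)))
    (hdetv : detv = h * ψv * (p1 * p3 - c ^ 2 * D * (G + 1) * rr) + h * ψu * (c * (G + 1) * rr * (p3 + c * D * rr))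
      + h * ψw * (c * D * rr * (p1 + c * (G + 1))))
    (hdetw : detw = h * ψw * (p1 * p2 - c ^ 2 * N * (G + 1) * rr) + h * ψv * (c * N * (p1 + c * (G + 1) * rr))
      + h * ψu * (c * (G + 1) * rr * (c * N + p2)))
    (hu : u = detu / det) (hv : v = detv / det) (hw : w = detw / det) : 0 ≤ u ∧ 0 ≤ v ∧ 0 ≤ w := by
  have hb := threeState_value_bounds (m := 0) (M' := max ψu (max ψv ψw)) ht hh hc hG hN hD hrr0 hψu hψv hψw (le_max_left _ _)
    ((le_max_left _ _).trans (le_max_right _ _)) ((le_max_right _ _).trans (le_max_right _ _)) hp1 hp2 hp3 hdet hdetu hdetv hdetw hu hv hw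
  exact ⟨hb.1.1, hb.2.1.1, hb.2.2.1⟩

/-! ## §4 The law for a potential `Ψa(D, N)`: only a separation and the redraw contraction remain -/

section Law
open Finset Function Matrix
open Literature.Probability.MarkovChains

variable {K m : ℕ} {μ : Fin (K + 1) → Bool → ℝ} {M : Fin (K + 1) → Bool → Bool → ℝ} {w : Fin (K + 1) → ℝ} {t : ℝ}
variable (κ : Fin m → Fin K) {cnt : (Fin (K + 1) → Bool) × (Fin (K + 1) → Bool) → Bool → Bool → ℝ}

omit κ in
/-- The four type counts of a pair sum to `K`. [ours] -/
theorem boolStar_cnt_total (hcnt : ∀ a s t, cnt a s t = ((univ.filter fun i : Fin K => a.1 i.succ = s ∧ a.2 i.succ = t).card : ℝ))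
    (b : Bool) (a : (Fin (K + 1) → Bool) × (Fin (K + 1) → Bool)) :
    cnt a b b + cnt a b (!b) + cnt a (!b) b + cnt a (!b) (!b) = K := by
  have h := sum_eq_sum_pairType (fun i : Fin K => a.1 i.succ) (fun i : Fin K => a.2 i.succ) (fun _ _ => (1 : ℝ))
  simp only [Finset.sum_const, Finset.card_univ, Fintype.card_fin, nsmul_eq_mul, mul_one] at h
  rw [Fintype.sum_prod_type, Fintype.sum_bool, Fintype.sum_bool, Fintype.sum_bool] at h
  simp only [← hcnt] at h
  cases b <;> simp only [Bool.not_true, Bool.not_false] <;> linarith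

/-- **THE LAW FOR A POTENTIAL `Ψa(D,N)` WITH THE EXACT THREE-STATE VALUES.**  Setting of `boolStar_mixingTime_le_of_threeState`; `U, V, W` are DEFINED as the Cramer
values of the class systems (`U(D,N)` from the class of `(bb; D, N)`: `G = K−D−N`; `V(D,N)` from the class of `(bb; D, N+1)`; `W(D,N)` from the class of `(bb; D+1, N)`),
with `c = t/K`, `h = (1−t)w_0`.  Then the three aligned equations and `U, V, W ≥ 0` hold automatically (`Ψa ≥ 0`), and the law
**`t_mix(ε) ≤ ⌈(4/((1−t)w_0·ρ))·log((e·Ψ_max+1)/ε)⌉₊`** follows from: `0 ≤ Ψa ≤ Ψ_max`, `Ψa ≥ 1` where a cold level differs, the SEPARATION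
`max{Ψa(D−1,N+1), Ψa(D−1,N), Ψa(D−2,N+1)} ≤ min{Ψa(D+1,N), Ψa(D+1,N−1), Ψa(D,N)}` on `D ≥ 1` (which gives the monotonicity `V(D−1,N) ≤ W(D,N)`, both values being weighted
averages of the potential over their classes), and the REDRAW CONTRACTION `μ_0(b)·U(D,N) + μ_0(b̄)·V(D,N) ≤ (1−ρ)·Ψa(D,N)` at every pair. [ours] -/
theorem boolStar_mixingTime_le_of_potential (hm : 1 ≤ m) (ht0 : 0 ≤ t) (ht1 : t < 1) (hw0 : ∀ k, 0 ≤ w k) (hw00 : 0 < w 0)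
    (hw1 : ∑ k, w k = 1) (hμ : ∀ k x, 0 < μ k x) (hμ1 : ∀ k, ∑ u, μ k u = 1) (hM0 : ∀ u v, M 0 u v = μ 0 v)
    (hidle : ∀ i : Fin K, ∀ u v, M i.succ u v = if v = u then 1 else 0) (hhom : ∀ i : Fin K, μ i.succ = μ 1)
    {c0 : ℕ} (hunif : ∀ i : Fin K, (univ.filter fun r : Fin m => κ r = i).card = c0)
    {b : Bool} (hb : μ 0 b * μ 1 (!b) ≤ μ 0 (!b) * μ 1 b) {rr : ℝ} (hrr : rr = μ 0 b * μ 1 (!b) / (μ 0 (!b) * μ 1 b))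
    (hcnt : ∀ a s t, cnt a s t = ((univ.filter fun i : Fin K => a.1 i.succ = s ∧ a.2 i.succ = t).card : ℝ))
    {Dc Nc : (Bool → Bool → ℝ) → ℝ} (hD : ∀ c, Dc c = c b (!b) + c (!b) b) (hN : ∀ c, Nc c = c (!b) (!b))
    {Ψa : ℝ → ℝ → ℝ} {Ψmax ρ : ℝ}
    {p1 p2 p3 det detu detv detw : ℝ → ℝ → ℝ → ℝ}
    (hp1 : ∀ G N D, p1 G N D = t + (1 - t) * w 0 - t / K * G)
    (hp2 : ∀ G N D, p2 G N D = t + (1 - t) * w 0 - t / K * ((G + 1) * (1 - rr) + (N - 1) + D * (1 - rr)))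
    (hp3 : ∀ G N D, p3 G N D = t + (1 - t) * w 0 - t / K * ((G + 1) * (1 - rr) + (D - 1)))
    (hdet : ∀ G N D, det G N D = p1 G N D * (p2 G N D * p3 G N D - (t / K * D * rr) * (t / K * N))
      - (t / K) ^ 2 * N * (G + 1) * rr * (p3 G N D + t / K * D * rr) - (t / K) ^ 2 * D * (G + 1) * rr * (t / K * N + p2 G N D))
    (hdetu : ∀ G N D, detu G N D = (1 - t) * w 0 * Ψa D N * (p2 G N D * p3 G N D - (t / K * D * rr) * (t / K * N))
      + (1 - t) * w 0 * Ψa D (N - 1) * (t / K * N * (p3 G N D + t / K * D)) + (1 - t) * w 0 * Ψa (D - 1) N * (t / K * D * (t / K * N * rr + p2 G N D)))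
    (hdetv : ∀ G N D, detv G N D = (1 - t) * w 0 * Ψa D (N - 1) * (p1 G N D * p3 G N D - (t / K) ^ 2 * D * (G + 1) * rr)
      + (1 - t) * w 0 * Ψa D N * (t / K * (G + 1) * rr * (p3 G N D + t / K * D * rr))
      + (1 - t) * w 0 * Ψa (D - 1) N * (t / K * D * rr * (p1 G N D + t / K * (G + 1))))
    (hdetw : ∀ G N D, detw G N D = (1 - t) * w 0 * Ψa (D - 1) N * (p1 G N D * p2 G N D - (t / K) ^ 2 * N * (G + 1) * rr)
      + (1 - t) * w 0 * Ψa D (N - 1) * (t / K * N * (p1 G N D + t / K * (G + 1) * rr))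
      + (1 - t) * w 0 * Ψa D N * (t / K * (G + 1) * rr * (t / K * N + p2 G N D)))
    {U V W : ℝ → ℝ → ℝ}
    (hU : ∀ D N, U D N = detu (K - D - N) N D / det (K - D - N) N D)
    (hV : ∀ D N, V D N = detv (K - D - N - 1) (N + 1) D / det (K - D - N - 1) (N + 1) D)
    (hW : ∀ D N, W D N = detw (K - D - N - 1) N (D + 1) / det (K - D - N - 1) N (D + 1))
    (hΨ0 : ∀ D N, 0 ≤ Ψa D N)
    (hΨmax : ∀ a : (Fin (K + 1) → Bool) × (Fin (K + 1) → Bool), Ψa (Dc (cnt a)) (Nc (cnt a)) ≤ Ψmax)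
    (hΨ1 : ∀ a : (Fin (K + 1) → Bool) × (Fin (K + 1) → Bool), (∃ i : Fin K, a.1 i.succ ≠ a.2 i.succ) → 1 ≤ Ψa (Dc (cnt a)) (Nc (cnt a)))
    (hρ0 : 0 < ρ) (hρ1 : ρ ≤ 1)
    (hsep : ∀ a : (Fin (K + 1) → Bool) × (Fin (K + 1) → Bool), 1 ≤ Dc (cnt a) →
      max (Ψa (Dc (cnt a) - 1) (Nc (cnt a) + 1)) (max (Ψa (Dc (cnt a) - 1) (Nc (cnt a))) (Ψa (Dc (cnt a) - 2) (Nc (cnt a) + 1)))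
        ≤ min (Ψa (Dc (cnt a) + 1) (Nc (cnt a))) (min (Ψa (Dc (cnt a) + 1) (Nc (cnt a) - 1)) (Ψa (Dc (cnt a)) (Nc (cnt a)))))
    (contr : ∀ a : (Fin (K + 1) → Bool) × (Fin (K + 1) → Bool),
      μ 0 b * U (Dc (cnt a)) (Nc (cnt a)) + μ 0 (!b) * V (Dc (cnt a)) (Nc (cnt a)) ≤ (1 - ρ) * Ψa (Dc (cnt a)) (Nc (cnt a)))
    {ε : ℝ} (hε : 0 < ε) :
    mixingTime (fun y z : Fin (K + 1) → Bool =>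
        t * ptGraphSwap μ (fun r : Fin m => (((0 : Fin (K + 1)), (κ r).succ) : Fin (K + 1) × Fin (K + 1))) (fun _ : Fin m => Equiv.refl Bool) y z
          + (1 - t) * prodKernel w M y z) (tensorFun μ) ε
      ≤ ⌈1 / ((1 - t) * w 0 * ρ / 4) * Real.log ((Real.exp 1 * Ψmax + 1) / ε)⌉₊ := by
  have hh : 0 < (1 - t) * w 0 := mul_pos (by linarith) hw00
  have hc : 0 ≤ t / K := div_nonneg ht0 (Nat.cast_nonneg K)
  -- `K ≥ 1` (from `m ≥ 1` and the uniform list), so `(t/K)·K = t`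
  have hmK : (m : ℝ) = c0 * K := uniformList_card κ hunif
  have hK0 : (K : ℝ) ≠ 0 := by
    intro h0; have : (m : ℝ) = 0 := by rw [hmK, h0, mul_zero]
    exact absurd (by exact_mod_cast this : m = 0) (by omega)
  have hcK : ∀ G N D : ℝ, G + N + D = K → t = t / K * (G + N + D) := fun G N D e => by rw [e]; field_simp
  obtain ⟨_, hrr0, hrr1⟩ := boolStar_acc_disliked (acc := fun u v => min 1 (μ 0 v * μ 1 u / (μ 0 u * μ 1 v))) hμ (fun u v => rfl) hb hrr
  have hc0' : ∀ a s t', 0 ≤ cnt a s t' := fun a s t' => by rw [hcnt]; exact Nat.cast_nonneg _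
  have htot := boolStar_cnt_total hcnt b
  -- the class of a configuration `a`: `G = cnt(b,b)`, `N = Nc`, `D = Dc`, `G + N + D = K`
  have hG : ∀ a : (Fin (K + 1) → Bool) × (Fin (K + 1) → Bool), (K : ℝ) - Dc (cnt a) - Nc (cnt a) = cnt a b b := fun a => by
    rw [hD, hN]; linarith [htot a]
  refine boolStar_mixingTime_le_of_threeState' κ hm ht0 ht1 hw0 hw00 hw1 hμ hμ1 hM0 hidle hhom hunif hb hrr hcnt hD hN
    (U := U) (V := V) (W := W) (Ψa := Ψa) (Ψmax := Ψmax) (ρ := ρ)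
    (fun a => ?_) (fun a => ?_) (fun a => ?_) (fun a hD1 => ?_) (fun a => ?_) (fun a => ?_) (fun a => ?_) (fun a => hΨ0 _ _) hΨmax hΨ1 hρ0 hρ1 contr hε
  · -- eqU: the first equation of the class of `(bb; D, N)`
    have hGND : cnt a b b + Nc (cnt a) + Dc (cnt a) = K := by linarith [hG a]
    obtain ⟨e, -, -⟩ := threeState_cramer (hp1 (cnt a b b) (Nc (cnt a)) (Dc (cnt a))) (hp2 (cnt a b b) (Nc (cnt a)) (Dc (cnt a)))
      (hp3 (cnt a b b) (Nc (cnt a)) (Dc (cnt a))) (hdet (cnt a b b) (Nc (cnt a)) (Dc (cnt a))) (hdetu (cnt a b b) (Nc (cnt a)) (Dc (cnt a)))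
      (hdetv (cnt a b b) (Nc (cnt a)) (Dc (cnt a))) (hdetw (cnt a b b) (Nc (cnt a)) (Dc (cnt a)))
      (threeState_det_pos (hcK _ _ _ hGND) hh hc (by linarith [hc0' a b b]) (by rw [hN]; exact hc0' _ _ _)
        (by rw [hD]; exact add_nonneg (hc0' _ _ _) (hc0' _ _ _)) hrr0 (hp1 _ _ _) (hp2 _ _ _) (hp3 _ _ _) (hdet _ _ _)).2.ne' rfl rfl rfl
    simp only [hU, hV, hW]
    rw [hG a, show (K : ℝ) - Dc (cnt a) - (Nc (cnt a) - 1) - 1 = cnt a b b by linarith [hG a],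
      show Nc (cnt a) - 1 + 1 = Nc (cnt a) by ring,
      show (K : ℝ) - (Dc (cnt a) - 1) - Nc (cnt a) - 1 = cnt a b b by linarith [hG a],
      show Dc (cnt a) - 1 + 1 = Dc (cnt a) by ring, show cnt a (!b) (!b) = Nc (cnt a) from (hN _).symm]
    exact e
  · -- eqV: the second equation of the class of `(bb; D, N+1)` (`G_U = cnt(b,b) − 1`)
    have hGND : (cnt a b b - 1) + (Nc (cnt a) + 1) + Dc (cnt a) = K := by linarith [hG a]
    obtain ⟨-, e, -⟩ := threeState_cramer (hp1 (cnt a b b - 1) (Nc (cnt a) + 1) (Dc (cnt a))) (hp2 (cnt a b b - 1) (Nc (cnt a) + 1) (Dc (cnt a)))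
      (hp3 (cnt a b b - 1) (Nc (cnt a) + 1) (Dc (cnt a))) (hdet (cnt a b b - 1) (Nc (cnt a) + 1) (Dc (cnt a)))
      (hdetu (cnt a b b - 1) (Nc (cnt a) + 1) (Dc (cnt a))) (hdetv (cnt a b b - 1) (Nc (cnt a) + 1) (Dc (cnt a)))
      (hdetw (cnt a b b - 1) (Nc (cnt a) + 1) (Dc (cnt a)))
      (threeState_det_pos (hcK _ _ _ hGND) hh hc (by linarith [hc0' a b b]) (by rw [hN]; linarith [hc0' a (!b) (!b)])
        (by rw [hD]; exact add_nonneg (hc0' _ _ _) (hc0' _ _ _)) hrr0 (hp1 _ _ _) (hp2 _ _ _) (hp3 _ _ _) (hdet _ _ _)).2.ne' rfl rfl rfl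
    simp only [hU, hV, hW]
    rw [show (K : ℝ) - Dc (cnt a) - (Nc (cnt a) + 1) = cnt a b b - 1 by linarith [hG a],
      show (K : ℝ) - Dc (cnt a) - Nc (cnt a) - 1 = cnt a b b - 1 by linarith [hG a],
      show (K : ℝ) - (Dc (cnt a) - 1) - (Nc (cnt a) + 1) - 1 = cnt a b b - 1 by linarith [hG a],
      show Dc (cnt a) - 1 + 1 = Dc (cnt a) by ring, show cnt a (!b) (!b) = Nc (cnt a) from (hN _).symm]
    rw [show cnt a b b - 1 + 1 = cnt a b b by ring, show Nc (cnt a) + 1 - 1 = Nc (cnt a) by ring] at e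
    exact e
  · -- eqW: the third equation of the class of `(bb; D+1, N)`
    have hGND : (cnt a b b - 1) + Nc (cnt a) + (Dc (cnt a) + 1) = K := by linarith [hG a]
    obtain ⟨-, -, e⟩ := threeState_cramer (hp1 (cnt a b b - 1) (Nc (cnt a)) (Dc (cnt a) + 1)) (hp2 (cnt a b b - 1) (Nc (cnt a)) (Dc (cnt a) + 1))
      (hp3 (cnt a b b - 1) (Nc (cnt a)) (Dc (cnt a) + 1)) (hdet (cnt a b b - 1) (Nc (cnt a)) (Dc (cnt a) + 1))
      (hdetu (cnt a b b - 1) (Nc (cnt a)) (Dc (cnt a) + 1)) (hdetv (cnt a b b - 1) (Nc (cnt a)) (Dc (cnt a) + 1))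
      (hdetw (cnt a b b - 1) (Nc (cnt a)) (Dc (cnt a) + 1))
      (threeState_det_pos (hcK _ _ _ hGND) hh hc (by linarith [hc0' a b b]) (by rw [hN]; exact hc0' _ _ _)
        (by rw [hD]; linarith [hc0' a b (!b), hc0' a (!b) b]) hrr0 (hp1 _ _ _) (hp2 _ _ _) (hp3 _ _ _) (hdet _ _ _)).2.ne' rfl rfl rfl
    simp only [hU, hV, hW]
    rw [show (K : ℝ) - (Dc (cnt a) + 1) - Nc (cnt a) = cnt a b b - 1 by linarith [hG a],
      show (K : ℝ) - (Dc (cnt a) + 1) - (Nc (cnt a) - 1) - 1 = cnt a b b - 1 by linarith [hG a],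
      show Nc (cnt a) - 1 + 1 = Nc (cnt a) by ring,
      show (K : ℝ) - Dc (cnt a) - Nc (cnt a) - 1 = cnt a b b - 1 by linarith [hG a], show cnt a (!b) (!b) = Nc (cnt a) from (hN _).symm]
    rw [show cnt a b b - 1 + 1 = cnt a b b by ring, show Dc (cnt a) + 1 - 1 = Dc (cnt a) by ring] at e
    exact e
  · -- monotonicity `V(D−1,N) ≤ W(D,N)` on `D ≥ 1`: both are weighted averages; separate them by `hsep`
    have hs := hsep a hD1
    set MB := max (Ψa (Dc (cnt a) - 1) (Nc (cnt a) + 1)) (max (Ψa (Dc (cnt a) - 1) (Nc (cnt a))) (Ψa (Dc (cnt a) - 2) (Nc (cnt a) + 1))) with hMB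
    set mA := min (Ψa (Dc (cnt a) + 1) (Nc (cnt a))) (min (Ψa (Dc (cnt a) + 1) (Nc (cnt a) - 1)) (Ψa (Dc (cnt a)) (Nc (cnt a)))) with hmA
    -- the class of `V(D−1,N)`: `(G, N+1, D−1)` with `G = cnt(b,b)`; normalise the potential's arguments first
    have hGB : cnt a b b + (Nc (cnt a) + 1) + (Dc (cnt a) - 1) = K := by linarith [hG a]
    have hu1 := hdetu (cnt a b b) (Nc (cnt a) + 1) (Dc (cnt a) - 1)
    have hv1 := hdetv (cnt a b b) (Nc (cnt a) + 1) (Dc (cnt a) - 1)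
    have hw1 := hdetw (cnt a b b) (Nc (cnt a) + 1) (Dc (cnt a) - 1)
    rw [show Nc (cnt a) + 1 - 1 = Nc (cnt a) by ring, show Dc (cnt a) - 1 - 1 = Dc (cnt a) - 2 by ring] at hu1 hv1 hw1
    have hVle := ((threeState_value_bounds (m := min (Ψa (Dc (cnt a) - 1) (Nc (cnt a) + 1)) (min (Ψa (Dc (cnt a) - 1) (Nc (cnt a))) (Ψa (Dc (cnt a) - 2) (Nc (cnt a) + 1))))
      (M' := MB) (hcK _ _ _ hGB) hh hc (by linarith [hc0' a b b]) (by rw [hN]; linarith [hc0' a (!b) (!b)]) (by linarith) hrr0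
      (min_le_left _ _) ((min_le_right _ _).trans (min_le_left _ _)) ((min_le_right _ _).trans (min_le_right _ _))
      (le_max_left _ _) ((le_max_left _ _).trans (le_max_right _ _)) ((le_max_right _ _).trans (le_max_right _ _))
      (hp1 _ _ _) (hp2 _ _ _) (hp3 _ _ _) (hdet _ _ _) hu1 hv1 hw1 rfl rfl rfl).2.1).2
    -- the class of `W(D,N)`: `(G−1, N, D+1)`
    have hGA : (cnt a b b - 1) + Nc (cnt a) + (Dc (cnt a) + 1) = K := by linarith [hG a]
    have hu2 := hdetu (cnt a b b - 1) (Nc (cnt a)) (Dc (cnt a) + 1)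
    have hv2 := hdetv (cnt a b b - 1) (Nc (cnt a)) (Dc (cnt a) + 1)
    have hw2 := hdetw (cnt a b b - 1) (Nc (cnt a)) (Dc (cnt a) + 1)
    rw [show Dc (cnt a) + 1 - 1 = Dc (cnt a) by ring] at hu2 hv2 hw2
    have hWge := ((threeState_value_bounds (m := mA) (M' := max (Ψa (Dc (cnt a) + 1) (Nc (cnt a))) (max (Ψa (Dc (cnt a) + 1) (Nc (cnt a) - 1)) (Ψa (Dc (cnt a)) (Nc (cnt a)))))
      (hcK _ _ _ hGA) hh hc (by linarith [hc0' a b b]) (by rw [hN]; exact hc0' _ _ _) (by rw [hD]; linarith [hc0' a b (!b), hc0' a (!b) b]) hrr0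
      (min_le_left _ _) ((min_le_right _ _).trans (min_le_left _ _)) ((min_le_right _ _).trans (min_le_right _ _))
      (le_max_left _ _) ((le_max_left _ _).trans (le_max_right _ _)) ((le_max_right _ _).trans (le_max_right _ _))
      (hp1 _ _ _) (hp2 _ _ _) (hp3 _ _ _) (hdet _ _ _) hu2 hv2 hw2 rfl rfl rfl).2.2).1
    rw [hV, hW, show (K : ℝ) - (Dc (cnt a) - 1) - Nc (cnt a) - 1 = cnt a b b by linarith [hG a],
      show (K : ℝ) - Dc (cnt a) - Nc (cnt a) - 1 = cnt a b b - 1 by linarith [hG a]]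
    exact hVle.trans (hs.trans hWge)
  · -- U ≥ 0
    have hGND : cnt a b b + Nc (cnt a) + Dc (cnt a) = K := by linarith [hG a]
    rw [hU, hG a]
    exact (threeState_solution_nonneg (hcK _ _ _ hGND) hh hc (by linarith [hc0' a b b]) (by rw [hN]; exact hc0' _ _ _)
      (by rw [hD]; exact add_nonneg (hc0' _ _ _) (hc0' _ _ _)) hrr0 (hΨ0 _ _) (hΨ0 _ _) (hΨ0 _ _) (hp1 _ _ _) (hp2 _ _ _) (hp3 _ _ _)
      (hdet _ _ _) (hdetu _ _ _) (hdetv _ _ _) (hdetw _ _ _) rfl rfl rfl).1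
  · -- V ≥ 0
    have hGND : (cnt a b b - 1) + (Nc (cnt a) + 1) + Dc (cnt a) = K := by linarith [hG a]
    rw [hV, show (K : ℝ) - Dc (cnt a) - Nc (cnt a) - 1 = cnt a b b - 1 by linarith [hG a]]
    exact (threeState_solution_nonneg (hcK _ _ _ hGND) hh hc (by linarith [hc0' a b b]) (by rw [hN]; linarith [hc0' a (!b) (!b)])
      (by rw [hD]; exact add_nonneg (hc0' _ _ _) (hc0' _ _ _)) hrr0 (hΨ0 _ _) (hΨ0 _ _) (hΨ0 _ _) (hp1 _ _ _) (hp2 _ _ _) (hp3 _ _ _)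
      (hdet _ _ _) (hdetu _ _ _) (hdetv _ _ _) (hdetw _ _ _) rfl rfl rfl).2.1
  · -- W ≥ 0
    have hGND : (cnt a b b - 1) + Nc (cnt a) + (Dc (cnt a) + 1) = K := by linarith [hG a]
    rw [hW, show (K : ℝ) - Dc (cnt a) - Nc (cnt a) - 1 = cnt a b b - 1 by linarith [hG a]]
    exact (threeState_solution_nonneg (hcK _ _ _ hGND) hh hc (by linarith [hc0' a b b]) (by rw [hN]; exact hc0' _ _ _)
      (by rw [hD]; linarith [hc0' a b (!b), hc0' a (!b) b]) hrr0 (hΨ0 _ _) (hΨ0 _ _) (hΨ0 _ _) (hp1 _ _ _) (hp2 _ _ _) (hp3 _ _ _)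
      (hdet _ _ _) (hdetu _ _ _) (hdetv _ _ _) (hdetw _ _ _) rfl rfl rfl).2.2

end Law

end Summit.Ventures.LatticeQCDFlow.Scaling

end
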